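import Literature.MathematicalPhysics.QuantumLattice.MPSBlockedTensorSweep
import Summits.Ventures.CertifiedManyBodySolver.Upper.UMPSKernelTwins
import HarnessLib

/-!
# Strip-cell certificates, bridge layer L3 (integer side): the kernel twins are sweeps; `castC` commutes

HONEST FRAMING: first certified bounds; not a superconductivity verdict; every number certified or
labelled float. Companion of `Theorems/M3x2EdgeSplitUpperEdgeCellSweep.lean` (the `ℂ` side) for the
INTEGER twins of `Upper/UMPSKernelTwins.lean` that a kernel-replayed certificate evaluates: with
`opSandwich A O M = Σ_{s t} O_{st} (A^s)ᴴ M A^t` over `ℤ` (trivial star, `ᴴ = ᵀ`) and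
`consTensor A B (s,u) = A^s B^u` (`Literature.MathematicalPhysics.QuantumLattice.MPSBlockedTensorSweep`),

* `heisenbergZ_eq_opSandwich` — `Φ^ℤ(B) = Σ_s (Aint s)ᵀ B (Aint s)` is the `O = 1` sweep;
* `bondImageZ_eq_opSandwich` — `Y^ℤ_X` is the `X`-weighted sweep of the blocked pair tensor;
* `castC_opSandwich` — `castC` (entrywise `ℤ → ℂ`) commutes with `opSandwich`, so a sweep identity
  evaluated by the kernel on integer data (e.g. the site-by-site factorisation
  `opSandwich_consTensor_kronecker` / `opSandwich_wordTensor_piOp`) holds for the cast complex matrices.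

Pure algebra, zero row value; serves crux `UpperEdge_le_m73o100` (route `M3x2EdgeSplit`) only as
bridge infrastructure (HOME `hubbard-upper-eng-1/eng-g26/BRIDGE-SPEC.md`, L3). 0 `sorry`, 0 `def`.
-/

namespace Summit.Ventures.CertifiedManyBodySolver.Theorems

open Matrix Literature.MathematicalPhysics.QuantumLattice Summit.Ventures.CertifiedManyBodySolver.Upper

section Twins

variable {q D : ℕ}

/-- The integer Heisenberg twin `Φ^ℤ(B) = Σ_s (Aint s)ᵀ B (Aint s)` is the `O = 1` sweep over `ℤ`
(trivial star: `ᴴ = ᵀ`). -/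
theorem heisenbergZ_eq_opSandwich (A : ZTensor q D) (B : Matrix (Fin D) (Fin D) ℤ) :
    heisenbergZ A B = opSandwich A 1 B := by
  rw [opSandwich_one, heisenbergZ]
  refine Finset.sum_congr rfl fun s _ => ?_
  rw [conjTranspose_eq_transpose_of_trivial, Matrix.mul_assoc]

/-- The integer bond-image twin `Y^ℤ_X` is the `X`-weighted sweep of the blocked pair tensor over `ℤ`. -/
theorem bondImageZ_eq_opSandwich (A : ZTensor q D) (X : Matrix (Fin q × Fin q) (Fin q × Fin q) ℤ) :
    bondImageZ A X = opSandwich (consTensor A A) X 1 := by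
  rw [bondImageZ_eq_sum_sum, opSandwich_def]
  simp only [consTensor_apply, Matrix.mul_one, conjTranspose_eq_transpose_of_trivial]

/-- **Reading an integer sweep in `ℂ`**: `castC` (entrywise `ℤ → ℂ`) commutes with `opSandwich`, so a
sweep identity evaluated by the kernel on integer data holds for the cast complex matrices. -/
theorem castC_opSandwich (A : ZTensor q D) (O : Matrix (Fin q) (Fin q) ℤ) (M : Matrix (Fin D) (Fin D) ℤ) :
    castC (opSandwich A O M) = opSandwich (fun s => castC (A s)) (castC O) (castC M) :=
  map_opSandwich (Int.castRingHom ℂ) (fun x => by simp) A O M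

end Twins

end Summit.Ventures.CertifiedManyBodySolver.Theorems
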